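import Literature.AlgebraicGeometry.Resolution.WeightedCentreLayerEquation
import Literature.AlgebraicGeometry.Resolution.WeightedCentreDirectionalDerivative
import Mathlib.Algebra.MvPolynomial.Monad
import HarnessLib

/-!
# From the `V ≠ 0` exit to "no upper pin" (E1 §5.5 ⟶ the hypothesis of Lemma F1)

Uniform value line: typed theorems in the polynomial weighted-centre model `W(f)` — NOT a
resolution theorem, NOT summit progress; AI review is weaker than expert review.

The `V ≠ 0` exit of the block step (`WeightedCentreOneRound`,
`IsBlockSubstitution.exists_lineSubst_notMem_vars`) produces a linear change `λ_v` of the block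
coordinates after which the top block layer of (a sector of) the face polynomial misses the block
variable `y_{k₀}`.  Lemma F1 (`WeightedCentreUpperPins`, `IsCentreFor.exists_lt_of_no_upperPin`)
wants: every face monomial through `y_{k₀}` contains a variable of weight `< γ_{k₀}` ("`k₀` has no
upper pin").  This file types the combinatorial bridge between the two (all statements derived
here), for one sector `m` (a polynomial free of the higher blocks, all of whose monomials have the
same valuation):

* `exists_lt_of_notMem_vars_top` — if `γ ≥ 0`, `γ = w > 0` on the block `B`, every non-block
  variable of `m` has weight `< w`, all monomials of `m` have valuation `c`, the block degree on
  `m` is `≤ E` with `[m]_E ≠ 0`, and `k₀ ∈ B` does not occur in `[m]_E`, then every monomial of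
  `m` through `X_{k₀}` contains a variable of weight `< γ_{k₀}`.  (A candidate upper pin is a
  pure-`B` monomial; its valuation `w·|d|_B = c` makes `|d|_B` maximal, i.e. `= E`.)
* `weightedHomogeneousComponent_map_of_graded` — an endomorphism preserving `w`-homogeneity of
  every degree commutes with the homogeneous components (any additive weight monoid);
  `isWeightedHomogeneous_lineSubst'` — `λ_v` is graded for every weight (e.g. the valuation
  `γ : σ → ℚ`) constant on the direction `v`; `vars_lineSubst_subset` — `λ_v` introduces no
  variable other than `k₀`; `monomialValuation_eq_weight`.
* `exists_lt_of_notMem_vars_lineSubst_top` — the bridge after the linear change: under the same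
  hypotheses on `m`, a direction `v` supported in `B` with `v_{k₀} ≠ 0` and
  `k₀ ∉ vars (λ_v [m]_E)` (the conclusion of the `V ≠ 0` exit) give the no-upper-pin property of
  `k₀` for `λ_v m`.
* `forall_support_sectorSum` — gluing the sectors: the property for every `m_ν` gives it for
  `H = Σ_ν m_ν X^ν` when `k₀` is not a tag variable.

References: [AbramovichTemkinWlodarczyk2024] §2.4 / Def. 2.4.1 (monomial valuation,
admissibility), §3.4 (p. 1570), §5.1 (p. 1575); [Hironaka1970AdditiveGroups] (the linear change
along a kernel vector); [HauserWagner2014] (T) (arXiv p. 14–15).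
-/

open MvPolynomial Finsupp

namespace Literature.AlgebraicGeometry.Resolution.WeightedBlowup

variable {K : Type*} [Field K] {σ : Type*} [DecidableEq σ]

/-! ## §1 Graded endomorphisms commute with the homogeneous components -/

omit [DecidableEq σ] in
/-- An algebra endomorphism mapping `w`-homogeneous polynomials of each degree to `w`-homogeneous
polynomials of the same degree commutes with `weightedHomogeneousComponent w n` (derived here).
[cite: AbramovichTemkinWlodarczyk2024, §3.4 (p. 1570)] -/
theorem weightedHomogeneousComponent_map_of_graded {M : Type*} [AddCommMonoid M] [DecidableEq M]
    (w : σ → M) (ψ : MvPolynomial σ K →ₐ[K] MvPolynomial σ K)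
    (hψ : ∀ (n : M) (P : MvPolynomial σ K),
      IsWeightedHomogeneous w P n → IsWeightedHomogeneous w (ψ P) n)
    (P : MvPolynomial σ K) (n : M) :
    weightedHomogeneousComponent w n (ψ P) = ψ (weightedHomogeneousComponent w n P) := by
  classical
  conv_lhs => rw [as_sum P, map_sum, map_sum]
  rw [weightedHomogeneousComponent_apply, map_sum, Finset.sum_filter]
  refine Finset.sum_congr rfl fun d _ => ?_
  rw [weightedHomogeneousComponent_of_mem
    (hψ _ _ (isWeightedHomogeneous_monomial w d (coeff d P) rfl))]
  by_cases h : weight w d = n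
  · rw [if_pos h.symm, if_pos h]
  · rw [if_neg (fun h' => h h'.symm), if_neg h]

omit [DecidableEq σ] in
/-- Graded substitutions for an arbitrary additive weight monoid (the `ℕ`-weighted case is
`isWeightedHomogeneous_aeval`). [folklore] -/
private theorem isWeightedHomogeneous_aeval' {M : Type*} [AddCommMonoid M] (w : σ → M)
    (θ : σ → MvPolynomial σ K) (hθ : ∀ i, IsWeightedHomogeneous w (θ i) (w i))
    {P : MvPolynomial σ K} {m : M} (hP : IsWeightedHomogeneous w P m) :
    IsWeightedHomogeneous w (aeval θ P) m := by
  classical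
  have hexp : aeval θ P = ∑ d ∈ P.support, C (coeff d P) * ∏ i ∈ d.support, θ i ^ d i := by
    rw [MvPolynomial.aeval_def, MvPolynomial.eval₂_eq]
    simp only [MvPolynomial.algebraMap_eq]
  rw [hexp]
  refine IsWeightedHomogeneous.sum _ _ _ fun d hd => ?_
  have hwd : weight w d = m := hP (MvPolynomial.mem_support_iff.mp hd)
  have hπ : IsWeightedHomogeneous w (∏ i ∈ d.support, θ i ^ d i) (∑ i ∈ d.support, d i • w i) :=
    IsWeightedHomogeneous.prod _ _ _ fun i _ => (hθ i).pow (d i)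
  have hs : ∑ i ∈ d.support, d i • w i = m := by
    rw [← hwd, weight_apply, Finsupp.sum]
  rw [hs] at hπ
  exact hπ.C_mul _

/-- `λ_v` preserves `w`-homogeneity for EVERY additive weight `w` constant on the direction `v`
(derived here; `isWeightedHomogeneous_lineSubst` is the `ℕ`-weighted case — here e.g. the
rational weights of the monomial valuation). [cite: AbramovichTemkinWlodarczyk2024, §5.2 (pp. 1576–1577)] -/
theorem isWeightedHomogeneous_lineSubst' {M : Type*} [AddCommMonoid M] (k₀ : σ) {v : σ → K}
    (w : σ → M) (hw : ∀ j, v j ≠ 0 → w j = w k₀) {F : MvPolynomial σ K} {n : M}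
    (hF : IsWeightedHomogeneous w F n) : IsWeightedHomogeneous w (lineSubst k₀ v F) n := by
  unfold lineSubst
  refine isWeightedHomogeneous_aeval' w (lineGen k₀ v) (fun j => ?_) hF
  unfold lineGen
  split_ifs with h
  · subst h
    have h1 := (isWeightedHomogeneous_C w (v j)).mul (isWeightedHomogeneous_X K w j)
    rwa [zero_add] at h1
  · by_cases hvj : v j = 0
    · rw [hvj, C_0, zero_mul, add_zero]
      exact isWeightedHomogeneous_X K w j
    · have h1 := (isWeightedHomogeneous_C w (v j)).mul (isWeightedHomogeneous_X K w k₀)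
      rw [zero_add, ← hw j hvj] at h1
      exact (isWeightedHomogeneous_X K w j).add h1

/-- `λ_v` introduces no variable other than `X_{k₀}`: `vars (λ_v P) ⊆ vars P ∪ {k₀}` (derived here).
[cite: Hironaka1970AdditiveGroups, additive forms and differential operators] -/
theorem vars_lineSubst_subset (k₀ : σ) (v : σ → K) (P : MvPolynomial σ K) :
    (lineSubst k₀ v P).vars ⊆ P.vars ∪ {k₀} := by
  classical
  have hgen : ∀ j, (lineGen k₀ v j).vars ⊆ ({j, k₀} : Finset σ) := by
    intro j i hi
    unfold lineGen at hi
    rw [Finset.mem_insert, Finset.mem_singleton]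
    split_ifs at hi with h
    · have h1 := vars_mul _ _ hi
      rw [vars_C, Finset.empty_union, vars_X, Finset.mem_singleton] at h1
      exact Or.inr h1
    · rcases Finset.mem_union.mp (vars_add_subset _ _ hi) with h2 | h2
      · rw [vars_X, Finset.mem_singleton] at h2
        exact Or.inl h2
      · have h3 := vars_mul _ _ h2
        rw [vars_C, Finset.empty_union, vars_X, Finset.mem_singleton] at h3
        exact Or.inr h3
  intro i hi
  rw [lineSubst, MvPolynomial.aeval_eq_bind₁] at hi
  obtain ⟨j, hj, hij⟩ := Finset.mem_biUnion.mp (vars_bind₁ _ _ hi)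
  have h := hgen j hij
  rw [Finset.mem_insert, Finset.mem_singleton] at h
  rcases h with h | h
  · rw [h]
    exact Finset.mem_union_left _ hj
  · rw [h]
    exact Finset.mem_union_right _ (Finset.mem_singleton_self _)

/-! ## §2 Monomial valuation versus block degree -/

omit [DecidableEq σ] in
/-- The monomial valuation is the `γ`-weight (rational weights). (derived here)
[cite: AbramovichTemkinWlodarczyk2024, §2.4 (monomial valuation of a center)] -/
theorem monomialValuation_eq_weight (γ : σ → ℚ) (d : σ →₀ ℕ) :
    monomialValuation γ d = weight γ d := by
  rw [weight_apply]
  simp only [monomialValuation, nsmul_eq_mul]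

omit [DecidableEq σ] in
/-- [folklore] -/
private theorem monomialValuation_eq_sum' (γ : σ → ℚ) (d : σ →₀ ℕ) :
    monomialValuation γ d = ∑ i ∈ d.support, (d i : ℚ) * γ i := by
  simp only [monomialValuation, Finsupp.sum]

/-- The block degree is the total degree in the block variables. [folklore] -/
private theorem blockDeg_eq_sum (B : Finset σ) (d : σ →₀ ℕ) :
    weight (blockWeight B) d = ∑ i ∈ d.support with i ∈ B, d i := by
  rw [weight_apply, Finsupp.sum, Finset.sum_filter]
  refine Finset.sum_congr rfl fun i _ => ?_
  by_cases hi : i ∈ B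
  · rw [blockWeight_of_mem hi, if_pos hi, smul_eq_mul, mul_one]
  · rw [blockWeight_of_not_mem hi, if_neg hi, smul_eq_mul, mul_zero]

/-- `w · |d|_B ≤ v_γ(d)` when `γ = w` on `B` and `γ ≥ 0`. [folklore] -/
private theorem mul_blockDeg_le_monomialValuation (γ : σ → ℚ) (hγ : ∀ i, 0 ≤ γ i) {w : ℚ}
    (B : Finset σ) (hB : ∀ i ∈ B, γ i = w) (d : σ →₀ ℕ) :
    w * (weight (blockWeight B) d : ℕ) ≤ monomialValuation γ d := by
  rw [monomialValuation_eq_sum', blockDeg_eq_sum, Nat.cast_sum, Finset.mul_sum, Finset.sum_filter]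
  refine Finset.sum_le_sum fun i _ => ?_
  split_ifs with hi
  · rw [hB i hi]
    exact le_of_eq (mul_comm _ _)
  · exact mul_nonneg (Nat.cast_nonneg _) (hγ i)

/-- `v_γ(d) = w · |d|_B` for a pure-block monomial. [folklore] -/
private theorem monomialValuation_eq_mul_blockDeg (γ : σ → ℚ) {w : ℚ} (B : Finset σ)
    (hB : ∀ i ∈ B, γ i = w) {d : σ →₀ ℕ} (hd : ∀ i ∈ d.support, i ∈ B) :
    monomialValuation γ d = w * (weight (blockWeight B) d : ℕ) := by
  rw [monomialValuation_eq_sum', blockDeg_eq_sum, Nat.cast_sum, Finset.mul_sum, Finset.sum_filter]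
  refine Finset.sum_congr rfl fun i hi => ?_
  rw [if_pos (hd i hi), hB i (hd i hi), mul_comm]

/-! ## §3 The pin criterion -/

/-- **No upper pin from a missing top-layer variable.**  Let `γ ≥ 0` be weights with `γ = w > 0`
on the block `B`, and let `m` be a polynomial every non-block variable of which has weight `< w`
(a sector: free of the higher blocks), all of whose monomials have valuation `c`, of block degree
`≤ E` with `[m]_E ≠ 0`.  If `k₀ ∈ B` does not occur in the top layer `[m]_E`, then every
monomial of `m` through `X_{k₀}` contains a variable of weight `< γ_{k₀}` (derived here: a
monomial through `X_{k₀}` with all weights `≥ w` is pure-block, and `w·|d|_B = c ≥ w·|d'|_B`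
for every monomial `d'` puts it in the top layer).
[cite: AbramovichTemkinWlodarczyk2024, Def. 2.4.1 (2) (p. 1568) and §5.1 (p. 1575)] -/
theorem exists_lt_of_notMem_vars_top (γ : σ → ℚ) (hγ : ∀ i, 0 ≤ γ i) {w : ℚ} (hw : 0 < w)
    (B : Finset σ) (hB : ∀ i ∈ B, γ i = w) {m : MvPolynomial σ K}
    (hhigh : ∀ i ∈ m.vars, i ∉ B → γ i < w)
    {c : ℚ} (hval : ∀ d ∈ m.support, monomialValuation γ d = c)
    {E : ℕ} (hE : ∀ d ∈ m.support, weight (blockWeight B) d ≤ E)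
    (hEne : weightedHomogeneousComponent (blockWeight B) E m ≠ 0)
    {k₀ : σ} (hk₀ : k₀ ∈ B)
    (htop : k₀ ∉ (weightedHomogeneousComponent (blockWeight B) E m).vars) :
    ∀ d ∈ m.support, d k₀ ≠ 0 → ∃ i, d i ≠ 0 ∧ γ i < γ k₀ := by
  classical
  intro d hd hdk
  by_contra hno
  -- every variable of `d` has weight `≥ w`, hence lies in `B`
  have hge : ∀ i ∈ d.support, w ≤ γ i := by
    intro i hi
    by_contra hlt
    refine hno ⟨i, Finsupp.mem_support_iff.mp hi, ?_⟩
    rw [hB k₀ hk₀]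
    exact not_le.mp hlt
  have hdB : ∀ i ∈ d.support, i ∈ B := by
    intro i hi
    by_contra hiB
    exact absurd (hhigh i ((mem_vars_iff_mem_support i).mpr ⟨d, hd, hi⟩) hiB) (not_lt.mpr (hge i hi))
  -- `d` has the maximal block degree among the monomials of `m`
  have hmax : ∀ d' ∈ m.support, weight (blockWeight B) d' ≤ weight (blockWeight B) d := by
    intro d' hd'
    have h1 := mul_blockDeg_le_monomialValuation γ hγ B hB d'
    rw [hval d' hd', ← hval d hd, monomialValuation_eq_mul_blockDeg γ B hB hdB] at h1
    exact_mod_cast le_of_mul_le_mul_left h1 hw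
  -- the top layer is attained, so `|d|_B = E`
  have hex : ∃ d', coeff d' (weightedHomogeneousComponent (blockWeight B) E m) ≠ 0 := by
    by_contra h
    apply hEne
    ext d'
    rw [coeff_zero]
    by_contra h'
    exact h ⟨d', h'⟩
  obtain ⟨d', hd'⟩ := hex
  have hd'w : weight (blockWeight B) d' = E ∧ coeff d' m ≠ 0 := by
    rw [coeff_weightedHomogeneousComponent] at hd'
    split_ifs at hd' with h
    · exact ⟨h, hd'⟩
    · exact absurd rfl hd'
  have hdE : weight (blockWeight B) d = E := by
    refine le_antisymm (hE d hd) ?_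
    have h1 := hmax d' (MvPolynomial.mem_support_iff.mpr hd'w.2)
    rw [hd'w.1] at h1
    exact h1
  -- so `d` is a monomial of the top layer through `k₀`
  apply htop
  refine (mem_vars_iff_mem_support k₀).mpr ⟨d, ?_, Finsupp.mem_support_iff.mpr hdk⟩
  rw [MvPolynomial.mem_support_iff, coeff_weightedHomogeneousComponent, if_pos hdE]
  exact MvPolynomial.mem_support_iff.mp hd

/-! ## §4 The criterion after the linear block change `λ_v` -/

/-- **The `V ≠ 0` exit feeds Lemma F1.**  Same hypotheses on the sector `m`; let `v` be a
direction supported in the block with `v_{k₀} ≠ 0` such that `k₀ ∉ vars (λ_v [m]_E)` (the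
conclusion of `IsBlockSubstitution.exists_lineSubst_notMem_vars`).  Then every monomial of
`λ_v m` through `X_{k₀}` contains a variable of weight `< γ_{k₀}`: in the new block coordinates
`k₀` has no upper pin on this sector (derived here; `λ_v` is graded for the block degree and for
the valuation, injective, and introduces no new variable).
[cite: AbramovichTemkinWlodarczyk2024, Def. 2.4.1 (2) (p. 1568) and §5.1 (p. 1575)]
[cite: Hironaka1970AdditiveGroups, additive forms and differential operators] -/
theorem exists_lt_of_notMem_vars_lineSubst_top (γ : σ → ℚ) (hγ : ∀ i, 0 ≤ γ i) {w : ℚ}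
    (hw : 0 < w) (B : Finset σ) (hB : ∀ i ∈ B, γ i = w) {m : MvPolynomial σ K}
    (hhigh : ∀ i ∈ m.vars, i ∉ B → γ i < w)
    {c : ℚ} (hval : ∀ d ∈ m.support, monomialValuation γ d = c)
    {E : ℕ} (hE : ∀ d ∈ m.support, weight (blockWeight B) d ≤ E)
    (hEne : weightedHomogeneousComponent (blockWeight B) E m ≠ 0)
    {k₀ : σ} (hk₀ : k₀ ∈ B) {v : σ → K} (hv0 : v k₀ ≠ 0) (hvB : ∀ j ∉ B, v j = 0)
    (htop : k₀ ∉ (lineSubst k₀ v (weightedHomogeneousComponent (blockWeight B) E m)).vars) :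
    ∀ d ∈ (lineSubst k₀ v m).support, d k₀ ≠ 0 → ∃ i, d i ≠ 0 ∧ γ i < γ k₀ := by
  classical
  have hvmem : ∀ j, v j ≠ 0 → j ∈ B := fun j hj => by
    by_contra h
    exact hj (hvB j h)
  have hwB : ∀ j, v j ≠ 0 → blockWeight B j = blockWeight B k₀ := fun j hj => by
    rw [blockWeight_of_mem (hvmem j hj), blockWeight_of_mem hk₀]
  have hwγ : ∀ j, v j ≠ 0 → γ j = γ k₀ := fun j hj => by
    rw [hB j (hvmem j hj), hB k₀ hk₀]
  have hcomm : ∀ n, weightedHomogeneousComponent (blockWeight B) n (lineSubst k₀ v m)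
      = lineSubst k₀ v (weightedHomogeneousComponent (blockWeight B) n m) := fun n =>
    weightedHomogeneousComponent_map_of_graded (blockWeight B) (lineSubst k₀ v)
      (fun _ _ hP => isWeightedHomogeneous_lineSubst k₀ (blockWeight B) hwB hP) m n
  -- valuation: `λ_v m` is `γ`-homogeneous of weight `c`
  have hmc : IsWeightedHomogeneous γ m c := by
    intro d hd
    rw [← monomialValuation_eq_weight]
    exact hval d (MvPolynomial.mem_support_iff.mpr hd)
  have hval' : ∀ d ∈ (lineSubst k₀ v m).support, monomialValuation γ d = c := by
    intro d hd
    rw [monomialValuation_eq_weight]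
    exact isWeightedHomogeneous_lineSubst' k₀ γ hwγ hmc (MvPolynomial.mem_support_iff.mp hd)
  -- non-block variables: unchanged
  have hhigh' : ∀ i ∈ (lineSubst k₀ v m).vars, i ∉ B → γ i < w := by
    intro i hi hiB
    rcases Finset.mem_union.mp (vars_lineSubst_subset k₀ v m hi) with h | h
    · exact hhigh i h hiB
    · rw [Finset.mem_singleton] at h
      rw [h] at hiB
      exact absurd hk₀ hiB
  -- block degrees: still `≤ E`, top layer still nonzero and missing `k₀`
  have hE' : ∀ d ∈ (lineSubst k₀ v m).support, weight (blockWeight B) d ≤ E := by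
    intro d hd
    by_contra hlt
    have hn : weightedHomogeneousComponent (blockWeight B) (weight (blockWeight B) d) m = 0 := by
      ext d''
      rw [coeff_weightedHomogeneousComponent, coeff_zero]
      split_ifs with h
      · by_contra hc
        apply hlt
        rw [← h]
        exact hE d'' (MvPolynomial.mem_support_iff.mpr hc)
      · rfl
    have h1 : coeff d (weightedHomogeneousComponent (blockWeight B) (weight (blockWeight B) d)
        (lineSubst k₀ v m)) = coeff d (lineSubst k₀ v m) := by
      rw [coeff_weightedHomogeneousComponent, if_pos rfl]
    rw [hcomm, hn, map_zero, coeff_zero] at h1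
    exact (MvPolynomial.mem_support_iff.mp hd) h1.symm
  have hEne' : weightedHomogeneousComponent (blockWeight B) E (lineSubst k₀ v m) ≠ 0 := by
    rw [hcomm]
    intro h0
    apply hEne
    apply (lineSubst_bijective k₀ hv0).1
    rw [h0, map_zero]
  have htop' : k₀ ∉ (weightedHomogeneousComponent (blockWeight B) E (lineSubst k₀ v m)).vars := by
    rw [hcomm]
    exact htop
  exact exists_lt_of_notMem_vars_top γ hγ hw B hB hhigh' hval' hE' hEne' hk₀ htop'

/-! ## §5 Gluing the sectors -/

omit [DecidableEq σ] in
/-- If every sector `m_ν` has the no-upper-pin property at `k₀` and `k₀` is not a tag variable,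
then so does `H = Σ_{ν ∈ A} m_ν X^ν` (derived here: a monomial of `H` is `e + ν` with `e` a
monomial of `m_ν`, and `(e + ν)_{k₀} = e_{k₀}`).
[cite: AbramovichTemkinWlodarczyk2024, Def. 2.4.1 (2) (p. 1568) and §5.1 (p. 1575)] -/
theorem forall_support_sectorSum {L : Finset σ} (A : Finset (σ →₀ ℕ))
    (hA : ∀ ν ∈ A, ∀ i ∈ ν.support, i ∈ L) (m : (σ →₀ ℕ) → MvPolynomial σ K) (γ : σ → ℚ)
    {k₀ : σ} (hk₀ : k₀ ∉ L)
    (hsec : ∀ ν ∈ A, ∀ e ∈ (m ν).support, e k₀ ≠ 0 → ∃ i, e i ≠ 0 ∧ γ i < γ k₀) :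
    ∀ d ∈ (∑ ν ∈ A, m ν * monomial ν 1).support, d k₀ ≠ 0 → ∃ i, d i ≠ 0 ∧ γ i < γ k₀ := by
  classical
  intro d hd hdk
  obtain ⟨ν, hν, hdν⟩ := Finset.mem_biUnion.mp (support_sum hd)
  obtain ⟨e, he, f, hf, rfl⟩ := Finset.mem_add.mp (support_mul _ _ hdν)
  have hf' : f = ν := Finset.mem_singleton.mp (support_monomial_subset hf)
  have hfk : f k₀ = 0 := by
    rw [hf']
    exact Finsupp.notMem_support_iff.mp fun h => hk₀ (hA ν hν k₀ h)
  have hek : e k₀ ≠ 0 := by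
    intro h0
    apply hdk
    rw [Finsupp.add_apply, h0, hfk]
  obtain ⟨i, hi, hlt⟩ := hsec ν hν e he hek
  refine ⟨i, fun h => hi ?_, hlt⟩
  rw [Finsupp.add_apply] at h
  exact Nat.eq_zero_of_add_eq_zero_right h

/-! ## §6 A worked instance -/

section Instance

/-- Weights `γ = (1/2, 1/2, 1/4)` on `K[X₀, X₁, X₂]`, block `B = {0, 1}` (`w = 1/2`), sector
`m = X₁² + X₀X₂²` (valuation `1` throughout; top block layer `X₁²`, which misses `X₀`): the only
monomial through `X₀` is `X₀X₂²`, and it contains the lower-weight variable `X₂` — `X₀` has no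
upper pin.  Checked directly on the support. [folklore] -/
example : ∀ d ∈ (X 1 ^ 2 + X 0 * X 2 ^ 2 : MvPolynomial (Fin 3) K).support, d 0 ≠ 0 →
    ∃ i, d i ≠ 0 ∧ (fun j : Fin 3 => if (j : ℕ) = 2 then (1/4 : ℚ) else 1/2) i
      < (fun j : Fin 3 => if (j : ℕ) = 2 then (1/4 : ℚ) else 1/2) 0 := by
  classical
  intro d hd hd0
  have h1 : (X 1 ^ 2 : MvPolynomial (Fin 3) K) = monomial (Finsupp.single 1 2) 1 := by
    rw [X_pow_eq_monomial]
  have h2 : (X 0 * X 2 ^ 2 : MvPolynomial (Fin 3) K) =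
      monomial (Finsupp.single 0 1 + Finsupp.single 2 2) 1 := by
    rw [X_pow_eq_monomial, X, monomial_mul, mul_one]
  rw [h1, h2] at hd
  rcases Finset.mem_union.mp (MvPolynomial.support_add hd) with h | h
  · have hd' := Finset.mem_singleton.mp (support_monomial_subset h)
    rw [hd'] at hd0
    simp at hd0
  · have hd' := Finset.mem_singleton.mp (support_monomial_subset h)
    refine ⟨2, ?_, ?_⟩
    · rw [hd']
      simp
    · norm_num

end Instance

end Literature.AlgebraicGeometry.Resolution.WeightedBlowup
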